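import Summits.NavierStokesRegularity.NavierStokesRegularity.Theorems.ClockStretchingLawClockCeilingUnidirectionalVorticityLiouville
import Literature.Analysis.FluidPDE.VorticityCalculus
import Literature.Analysis.FluidPDE.SpaceTimeCalculusC1
import HarnessLib
/-!
# Route `ScaledTopAlignment`: the NON-UNIDIRECTIONAL END of a non-trivial Type-I ancient mild field, a
# uniform vorticity floor on compact slice intervals, and slice selection under a final-density bound
# (support for the deciding crux W3ʷᵇ = `AprioriWindowBulkAlignment`, stmt-NavierStokesRegularity-19447,
# and its planned MOST-TIMES weakening W3ᵐᵗ; no import of the route file)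

Ingredients 2–4 of the most-times glue kit (`ScaledTopAlignmentMostTimesGlueKit`):

* `exists_end_curl_not_unidirectional` — **a non-trivial Type-I ancient mild field has a
  NON-UNIDIRECTIONAL vorticity END**: the lines of translation invariance of the slices form subspaces
  nested forward in time (forward uniqueness, `stub_translationInvariantAfter`), constant on a far-past
  end (`exists_end_submodule_const`); a non-zero stabilised line would make the field vanish (2.5-D
  Liouville `stub_lineLiouvilleEnd` + `vanishes_of_vanishes_before`), so on that end no slice vorticity
  is parallel to one vector (`stub_sliceInvariantOfCurlParallel`) — the architecture of Giga–Miura 2011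
  §2.1 / the tree's `unidirectionalVorticityLiouville` run backwards;
* `exists_curl_floor_Icc` — on a compact slice interval of that end the slice vorticities have a uniform
  amplitude floor (joint continuity + compactness);
* `exists_slice_time_notMem` — a time set of final density `≤ θ` at `T` misses, at every small scale
  `μ`, the physical time `T + μ s` of some slice `s ∈ (a, b]` whenever `θ|a| < b − a`;
* `tendsto_extend_of_strictMono` — sub-sequence bookkeeping for the diagonal zoom.
WHAT THIS IS NOT: not NS regularity; nothing here proves any door. References: Giga–Miura, CMP 303 (2011)
= HUPS #956, Thm 1.1, §2.1 [GigaMiura2011]; KNSS, Acta Math. 203 (2009), Thm 5.1, §6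
[KochNadirashviliSereginSverak2009]; Giga–Gu–Hsu 2019 §2.4 [GigaGuHsu2019].
-/

noncomputable section
-- the summit and its single sub-problem share the name (CONVENTIONS §1), as in every Theorems file
set_option linter.dupNamespace false
open MeasureTheory Set Function Filter Topology Metric
open scoped RealInnerProductSpace ENNReal
namespace Summit.NavierStokesRegularity.NavierStokesRegularity.Theorems
open Literature.Analysis Literature.Analysis.FluidPDE
open Summit.NavierStokesRegularity.NavierStokesRegularity.Theorems.SymmetryModuliCountSymmetricLiouville

/-! ### A non-trivial Type-I ancient mild field has a non-unidirectional vorticity end -/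

/-- **Non-unidirectional end.** If `u ∈ A_C` (`IsTypeIAncientMild C u`) is not identically zero, then
on some far-past end `t < t₁ < 0` NO slice vorticity `curl u(t, ·)` is everywhere parallel to one
non-zero vector. (Contrapositive-plus-stabilisation form of the tree's `unidirectionalVorticityLiouville`:
the subspaces of invariance lines of the slices are nested forward in time; on the end where they are
constant they must be `{0}`, else the 2.5-D Liouville theorem kills `u`; and a unidirectional slice is
invariant along its direction.) [cite: GigaMiura2011, Thm 1.1 and §2.1 (Commun. Math. Phys. 303 (2011) 289–300)] -/
theorem exists_end_curl_not_unidirectional {C : ℝ}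
    {u : ℝ → EuclideanSpace ℝ (Fin 3) → EuclideanSpace ℝ (Fin 3)} (hu : IsTypeIAncientMild C u)
    (hne : ∃ t < (0 : ℝ), ∃ x, u t x ≠ 0) :
    ∃ t₁ < (0 : ℝ), ∀ t < t₁, ¬ ∃ e : EuclideanSpace ℝ (Fin 3), e ≠ 0 ∧
      ∀ x, ∃ a : ℝ, curl (u t) x = a • e := by
  -- adapted from the tree's `unidirectionalVorticityLiouville` (same submodule family)
  let W : ℝ → Submodule ℝ (EuclideanSpace ℝ (Fin 3)) := fun t =>
    { carrier := {b | ∀ (h : ℝ) (x : EuclideanSpace ℝ (Fin 3)), u t (x + h • b) = u t x}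
      add_mem' := fun {a b} ha hb h x => by
        rw [smul_add, ← add_assoc, hb h (x + h • a), ha h x]
      zero_mem' := fun h x => by rw [smul_zero, add_zero]
      smul_mem' := fun c b hb h x => by rw [smul_smul]; exact hb (h * c) x }
  have hmemW : ∀ (t : ℝ) (b : EuclideanSpace ℝ (Fin 3)),
      b ∈ W t ↔ ∀ (h : ℝ) (x : EuclideanSpace ℝ (Fin 3)), u t (x + h • b) = u t x :=
    fun _ _ => Iff.rfl
  have hmono : ∀ s t : ℝ, s < t → t < 0 → W s ≤ W t := by
    intro s t hst ht b hb
    rw [hmemW] at hb ⊢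
    intro h x
    exact stub_translationInvariantAfter C u hu s (h • b) (hst.trans ht) (fun y => hb h y) t hst ht x
  obtain ⟨t₁, ht₁, hconst⟩ := exists_end_submodule_const W hmono
  refine ⟨t₁, ht₁, fun t ht hdir => ?_⟩
  obtain ⟨e, he, hpar⟩ := hdir
  have ht0 : t < 0 := ht.trans ht₁
  -- the unidirectional slice is invariant along `e`, so `e ∈ W t = W t₁`
  have hinvt : ∀ (h : ℝ) (x : EuclideanSpace ℝ (Fin 3)), u t (x + h • e) = u t x := fun h x =>
    stub_sliceInvariantOfCurlParallel (u t) ((hu.contDiff_slice ht0).of_le (WithTop.coe_le_coe.mpr le_top))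
      (hu.isDivFree ht0) ⟨C / Real.sqrt (-t), fun x => hu.norm_le ht0 x⟩ e he hpar x h
  have heW₁ : e ∈ W t₁ := by rw [← hconst t ht]; exact (hmemW t e).2 hinvt
  -- hence `u` is invariant along `e` on the whole end, and vanishes
  have hinv : ∀ t' < t₁, ∀ (x : EuclideanSpace ℝ (Fin 3)) (s : ℝ), u t' (x + s • e) = u t' x := by
    intro t' ht' x s
    have hmem : e ∈ W t' := by rw [hconst t' ht']; exact heW₁
    exact (hmemW t' e).1 hmem s x
  have hbefore : ∀ t' < t₁, ∀ x, u t' x = 0 := stub_lineLiouvilleEnd C u hu e t₁ he ht₁.le hinv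
  obtain ⟨t₀, ht₀, x₀, hx₀⟩ := hne
  exact hx₀ (vanishes_of_vanishes_before hu ht₁ hbefore t₀ ht₀ x₀)

/-- **Uniform vorticity floor on a compact slice interval.** If every slice vorticity `curl u(s)`,
`s ∈ [a, b]` (`b < 0`), of a Type-I ancient mild field is somewhere non-zero, then for some `m > 0`
every such slice exceeds `m` somewhere (joint continuity of `(s, y) ↦ curl u(s)(y)` + compactness).
[folklore] -/
theorem exists_curl_floor_Icc {C : ℝ}
    {u : ℝ → EuclideanSpace ℝ (Fin 3) → EuclideanSpace ℝ (Fin 3)} (hu : IsTypeIAncientMild C u)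
    {a b : ℝ} (hb : b < 0) (hS : ∀ s ∈ Icc a b, ∃ y, curl (u s) y ≠ 0) :
    ∃ m : ℝ, 0 < m ∧ ∀ s ∈ Icc a b, ∃ y, m < ‖curl (u s) y‖ := by
  by_contra hno
  push Not at hno
  have hseq : ∀ n : ℕ, ∃ s ∈ Icc a b, ∀ y, ‖curl (u s) y‖ ≤ 1 / ((n : ℝ) + 1) :=
    fun n => hno _ (by positivity)
  choose σ hσmem hσle using hseq
  obtain ⟨s₀, hs₀mem, ψ, hψ, hlim⟩ := isCompact_Icc.tendsto_subseq hσmem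
  have hs₀ : s₀ < 0 := lt_of_le_of_lt hs₀mem.2 hb
  obtain ⟨y, hy⟩ := hS s₀ hs₀mem
  have hcont : ContinuousOn (fun z : ℝ × EuclideanSpace ℝ (Fin 3) => fderiv ℝ (u z.1) z.2)
      (Iio 0 ×ˢ univ) :=
    continuousOn_fderiv_slice_of_contDiffOn (hu.contDiffOn.of_le (by exact_mod_cast le_top))
      isOpen_Iio.uniqueDiffOn
  have hz : Tendsto (fun n => ((σ (ψ n), y) : ℝ × EuclideanSpace ℝ (Fin 3))) atTop
      (𝓝[Iio 0 ×ˢ univ] (s₀, y)) :=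
    tendsto_nhdsWithin_iff.2 ⟨hlim.prodMk_nhds tendsto_const_nhds,
      Eventually.of_forall fun n => ⟨lt_of_le_of_lt (hσmem (ψ n)).2 hb, mem_univ _⟩⟩
  have hD : Tendsto (fun n => fderiv ℝ (u (σ (ψ n))) y) atTop (𝓝 (fderiv ℝ (u s₀) y)) :=
    (hcont (s₀, y) ⟨hs₀, mem_univ _⟩).tendsto.comp hz
  have hcurl : Tendsto (fun n => curl (u (σ (ψ n))) y) atTop (𝓝 (curl (u s₀) y)) := by
    show Tendsto (fun n => curlCLM (fderiv ℝ (u (σ (ψ n))) y)) atTop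
      (𝓝 (curlCLM (fderiv ℝ (u s₀) y)))
    exact (curlCLM.continuous.tendsto _).comp hD
  have hzero : Tendsto (fun n => curl (u (σ (ψ n))) y) atTop (𝓝 0) :=
    squeeze_zero_norm (fun n => hσle (ψ n) y)
      ((tendsto_one_div_add_atTop_nhds_zero_nat (𝕜 := ℝ)).comp hψ.tendsto_atTop)
  exact hy (tendsto_nhds_unique hcurl hzero)

/-! ### Slice selection under a final-density bound, and sub-sequence bookkeeping -/

/-- **Slice selection.** If `E` has final density `≤ θ` at `T` up to scale `h0`
(`volume (E ∩ (T−h, T)) ≤ θ h` for `0 < h < h0`) and `[a, b]`, `a < b < 0`, is long enough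
(`θ|a| < b − a`), then at every scale `μ > 0` with `μ|a| < h0` some slice `s ∈ (a, b]` has its
physical time `T + μ s` outside `E` (else the image interval, of length `μ(b − a)`, would lie in
`E ∩ (T − μ|a|, T)`). [folklore] -/
theorem exists_slice_time_notMem {T μ a b h0 θ : ℝ} {E : Set ℝ} (hμ : 0 < μ) (hab : a < b)
    (hb : b < 0) (hθab : θ * (-a) < b - a)
    (hE : ∀ h : ℝ, 0 < h → h < h0 → volume (E ∩ Ioo (T - h) T) ≤ ENNReal.ofReal (θ * h))
    (hh0 : μ * (-a) < h0) :
    ∃ s ∈ Ioc a b, T + μ * s ∉ E := by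
  by_contra hno
  push Not at hno
  have ha : a < 0 := hab.trans hb
  have hhpos : 0 < μ * (-a) := mul_pos hμ (neg_pos.2 ha)
  have hsub : Ioc (T + μ * a) (T + μ * b) ⊆ E ∩ Ioo (T - μ * (-a)) T := by
    intro t ht
    refine ⟨?_, by linarith [ht.1], ?_⟩
    · have hs : (t - T) / μ ∈ Ioc a b :=
        ⟨by rw [lt_div_iff₀ hμ]; linarith [ht.1], by rw [div_le_iff₀ hμ]; linarith [ht.2]⟩
      have h := hno _ hs
      have e : T + μ * ((t - T) / μ) = t := by field_simp; ring
      rwa [e] at h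
    · have : μ * b < 0 := mul_neg_of_pos_of_neg hμ hb
      linarith [ht.2]
  have hvol : volume (Ioc (T + μ * a) (T + μ * b)) = ENNReal.ofReal (μ * (b - a)) := by
    rw [Real.volume_Ioc]; congr 1; ring
  have hle : ENNReal.ofReal (μ * (b - a)) ≤ ENNReal.ofReal (θ * (μ * (-a))) := by
    rw [← hvol]; exact (measure_mono hsub).trans (hE _ hhpos hh0)
  have hlt : θ * (μ * (-a)) < μ * (b - a) := by
    have := mul_lt_mul_of_pos_left hθab hμ
    linarith [show θ * (μ * (-a)) = μ * (θ * (-a)) by ring]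
  exact absurd hle (not_le.2 ((ENNReal.ofReal_lt_ofReal_iff (mul_pos hμ (by linarith))).2 hlt))

/-- A sequence converging to `s`, re-indexed along a strictly monotone `k : ℕ → ℕ` and extended by the
constant `s` off the range of `k`, still converges to `s`. [folklore] -/
theorem tendsto_extend_of_strictMono {k : ℕ → ℕ} (hk : StrictMono k) {σ : ℕ → ℝ} {s : ℝ}
    (hσ : Tendsto σ atTop (𝓝 s)) : Tendsto (Function.extend k σ fun _ => s) atTop (𝓝 s) := by
  intro U hU
  obtain ⟨i₀, hi₀⟩ := eventually_atTop.1 (hσ hU)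
  refine mem_map.2 (eventually_atTop.2 ⟨k i₀, fun j hj => ?_⟩)
  by_cases h : ∃ i, k i = j
  · obtain ⟨i, rfl⟩ := h
    rw [hk.injective.extend_apply]
    exact hi₀ i (hk.le_iff_le.1 hj)
  · rw [Function.extend_apply' _ _ _ h]
    exact mem_of_mem_nhds hU

end Summit.NavierStokesRegularity.NavierStokesRegularity.Theorems
end
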